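import Literature.Analysis.OperatorTheory.YangMillsMatrixModelEnergyBilinear
import Literature.Analysis.Distribution.EllipticRegularityProofs
import Literature.Analysis.Distribution.DivFormRegularity
import Literature.Analysis.Calculus.SmoothRepresentativeGlue
import Mathlib.Analysis.Distribution.AEEqOfIntegralContDiff
import HarnessLib

/-!
# Weak `L¹_loc` eigenfunctions of Lüscher's matrix-model Hamiltonian are smooth classical eigenfunctions

Topic `Literature/Analysis/OperatorTheory`; the elliptic-regularity step (N3/N4 of the cell `ym-beyond`'s AL1 map,
and of the discharge of `LuscherSimonGap`) for `𝔥 = −½Δ + V` on `ℝ⁹`, `V(x) = ¼ Σ_{i,j} |x_i × x_j|²`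
(`YangMillsMatrixModelDiscreteSpectrum.lean`, `hApply` of `YangMillsMatrixModelEigenfunctions.lean`):

★ `exists_contDiff_classical_of_weak` — if `w ∈ L¹_loc(ℝ⁹)` satisfies the DISTRIBUTIONAL eigen-equation
`∫ w (𝔥φ) = E ∫ w φ` for every `φ ∈ C_c^∞(ℝ⁹)`, then `w` agrees a.e. with a `C^∞` function `w̃` which is a
CLASSICAL solution, `𝔥w̃(x) = −½Δw̃(x) + V(x)w̃(x) = E w̃(x)` for all `x`.

Proof = three tree theorems and one Mathlib lemma: (1) `V` is a polynomial, hence `C^∞`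
(`contDiff_luscherPotential`); (2) interior regularity for the divergence-form operator `Σ_i ∂_i(½ ∂_i ·) − (V − E)`
(Folland, *Introduction to PDE*, Cor. (6.34): elliptic operators with `C^∞` coefficients are hypoelliptic — in
the tree `Literature.Analysis.Distribution.Folland1995_cor634_holds` read through
`exists_contDiffOn_ae_eq_of_divForm_weak`) gives a smooth representative near every point; (3) the local
representatives glue (`Literature.Analysis.Calculus.exists_contDiff_ae_eq_of_locally`); (4) Green's second
identity on the core (`integral_hApply_mul_eq_integral_mul_hApply`) turns the distributional equation for the
`C^∞` representative into `∫ (𝔥w̃ − E w̃) φ = 0` for all test `φ`, and the fundamental lemma of the calculus of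
variations (`ae_eq_zero_of_integral_contDiff_smul_eq_zero`) plus continuity gives the pointwise equation.

This is the statement «eigenfunctions of `−½Δ + V`, `V ∈ C^∞`, are `C^∞` classical solutions»
(Gilbarg–Trudinger Thm 8.8 / Cor 8.11 / Thm 6.17 as cited in AL1's docstring; Reed–Simon IV §XIII.11;
Lieb–Loss Thm 11.7 (vi)).  Theorems only: no definitions, no named facts, no instances.

## References
* [Folland2020] G. B. Folland, *Introduction to Partial Differential Equations*, 2nd ed., Cor. (6.34).
* [GilbargTrudinger2001] D. Gilbarg, N. Trudinger, *Elliptic PDE of Second Order*, Cor. 8.11, Thm. 6.17.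
* [LiebLoss2001] E. H. Lieb, M. Loss, *Analysis*, 2nd ed., Thm. 11.7 (regularity of solutions), (vi).
-/

noncomputable section

open MeasureTheory Filter Set Function
open scoped ContDiff Topology BigOperators

namespace Literature.Analysis.OperatorTheory.YMMatrixModel

open Literature.Analysis.Distribution Literature.Analysis.Calculus

/-! ### 1. Smoothness of the potential -/

/-- The coordinates of `ℝ⁹ = (ℝ³)³` are smooth. [cite: LiebLoss2001, Thm. 11.7] -/
theorem contDiff_coordZM (p : Fin 3 × Fin 3) {n : WithTop ℕ∞} : ContDiff ℝ n fun x : ZM => x p :=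
  (PiLp.proj 2 (𝕜 := ℝ) (fun _ : Fin 3 × Fin 3 => ℝ) p).contDiff

/-- The Gram entries `x ↦ x_i · x_j` are smooth (polynomials). [cite: LiebLoss2001, Thm. 11.7] -/
theorem contDiff_colourDot (i j : Fin 3) {n : WithTop ℕ∞} :
    ContDiff ℝ n fun x : ZM => colourVec x i ⬝ᵥ colourVec x j := by
  simp only [dotProduct, colourVec]
  exact ContDiff.sum fun a _ => (contDiff_coordZM (i, a)).mul (contDiff_coordZM (j, a))

/-- **Lüscher's potential is smooth**: `V(x) = ¼ Σ_{i,j} (|x_i|²|x_j|² − (x_i·x_j)²)` (Lagrange's identity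
`|u × v|² = |u|²|v|² − (u·v)²`) is a polynomial in the coordinates. [cite: SimonB1983DiscreteSpectrum, eq. (3) p. 211] -/
theorem contDiff_luscherPotential {n : WithTop ℕ∞} : ContDiff ℝ n luscherPotential := by
  have h : luscherPotential = fun x => (1 / 4 : ℝ) * ∑ i, ∑ j,
      ((colourVec x i ⬝ᵥ colourVec x i) * (colourVec x j ⬝ᵥ colourVec x j) -
        (colourVec x i ⬝ᵥ colourVec x j) * (colourVec x j ⬝ᵥ colourVec x i)) := by
    funext x
    simp only [luscherPotential, cross_dot_cross]
  rw [h]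
  exact contDiff_const.mul (ContDiff.sum fun i _ => ContDiff.sum fun j _ =>
    ((contDiff_colourDot i i).mul (contDiff_colourDot j j)).sub
      ((contDiff_colourDot i j).mul (contDiff_colourDot j i)))

/-! ### 2. Bookkeeping: the divergence-form presentation of `𝔥 − E` in the standard basis -/

section Presentation

variable {φ : ZM → ℝ}

/-- The standard orthonormal basis vector of `ℝ⁹` indexed by `p` is the tree's unit direction `e_p`.
[cite: ReedSimonIV1978, Thm. XIII.2] -/
theorem basisFun_toBasis_apply (p : Fin 3 × Fin 3) :
    (EuclideanSpace.basisFun (Fin 3 × Fin 3) ℝ).toBasis p = unitDir p := by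
  rw [OrthonormalBasis.coe_toBasis, EuclideanSpace.basisFun_apply]
  rfl

/-- For a `C²` function, `∂_j (a ∂_i φ) = a ∂_j∂_i φ` for a constant `a`. [cite: ReedSimonIV1978, Thm. XIII.2] -/
theorem fderiv_const_mul_pderiv (hφ : ContDiff ℝ 2 φ) (a : ℝ) (i j : Fin 3 × Fin 3) (x : ZM) :
    fderiv ℝ (fun y => a * fderiv ℝ φ y (unitDir i)) x (unitDir j) = a * pderiv j (pderiv i φ) x := by
  have hd : DifferentiableAt ℝ (pderiv i φ) x := (differentiable_pderiv_of_contDiff_two hφ i) x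
  have h1 : (fun y => a * fderiv ℝ φ y (unitDir i)) = fun y => a * pderiv i φ y := rfl
  rw [h1, fderiv_const_mul hd a]
  rfl

/-- The divergence-form expression `Σ_i Σ_j ∂_j(a_{ij} ∂_i φ)` with `a_{ij} = ½ δ_{ij}` is `½ Δφ`.
[cite: ReedSimonIV1978, Thm. XIII.2] -/
theorem sum_fderiv_half_delta_eq_half_laplacian (hφ : ContDiff ℝ 2 φ) (x : ZM) :
    (∑ i : Fin 3 × Fin 3, ∑ j : Fin 3 × Fin 3,
      fderiv ℝ (fun y => (if i = j then (1 / 2 : ℝ) else 0) * fderiv ℝ φ y (unitDir i)) x (unitDir j)) =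
      (1 / 2 : ℝ) * laplacian φ x := by
  have h : ∀ i j : Fin 3 × Fin 3,
      fderiv ℝ (fun y => (if i = j then (1 / 2 : ℝ) else 0) * fderiv ℝ φ y (unitDir i)) x (unitDir j) =
        (if i = j then (1 / 2 : ℝ) else 0) * pderiv j (pderiv i φ) x :=
    fun i j => fderiv_const_mul_pderiv hφ _ i j x
  simp only [h]
  rw [laplacian_def, Finset.mul_sum]
  refine Finset.sum_congr rfl fun i _ => ?_
  rw [Finset.sum_eq_single i (fun j _ hji => by rw [if_neg (Ne.symm hji), zero_mul])
    (fun hi => absurd (Finset.mem_univ i) hi), if_pos rfl]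

end Presentation

/-! ### 3. Local and global smooth representatives of weak eigenfunctions -/

section Regularity

variable {w : ZM → ℝ} {E : ℝ}

/-- A locally integrable function times a compactly supported continuous function is integrable.
[cite: LiebLoss2001, Thm. 11.7] -/
private theorem integrable_mul_of_locallyIntegrable (hw : LocallyIntegrable w volume) {g : ZM → ℝ}
    (hg : Continuous g) (hgs : HasCompactSupport g) : Integrable (fun x => w x * g x) := by
  have h := hw.integrable_smul_right_of_hasCompactSupport hg hgs
  simpa only [smul_eq_mul] using h

/-- **Interior regularity, local form.**  A locally integrable distributional solution `w` of
`∫ w (𝔥φ) = E ∫ w φ` (`φ ∈ C_c^∞`) agrees, near every point, a.e. with a `C^∞` function (Folland Cor. (6.34)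
for the elliptic operator `½Δ − (V − E)` with polynomial coefficients, via the tree's
`exists_contDiffOn_ae_eq_of_divForm_weak` and `Folland1995_cor634_holds`). [cite: Folland2020, Cor. (6.34)] -/
theorem exists_local_contDiffOn_rep_of_weak (hw : LocallyIntegrable w volume)
    (hweak : ∀ φ : ZM → ℝ, ContDiff ℝ ∞ φ → HasCompactSupport φ →
      ∫ x, w x * hApply φ x = E * ∫ x, w x * φ x)
    (x₀ : ZM) :
    ∃ U : Set ZM, IsOpen U ∧ x₀ ∈ U ∧
      ∃ w' : ZM → ℝ, ContDiffOn ℝ ∞ w' U ∧ ∀ᵐ x ∂volume, x ∈ U → w x = w' x := by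
  classical
  have hV : ContDiff ℝ ∞ luscherPotential := contDiff_luscherPotential
  -- the hypotheses of the tree's regularity theorem
  have ha : ∀ i j : Fin 3 × Fin 3,
      ContDiffOn ℝ ∞ (fun _ : ZM => if i = j then (1 / 2 : ℝ) else 0) univ := fun i j =>
    contDiffOn_const
  have hpos : ∀ x ∈ (univ : Set ZM), ∀ v : Fin 3 × Fin 3 → ℝ, v ≠ 0 →
      0 < ∑ i, ∑ j, (if i = j then (1 / 2 : ℝ) else 0) * (v i * v j) := by
    intro x _ v hv
    have h1 : ∑ i, ∑ j, (if i = j then (1 / 2 : ℝ) else 0) * (v i * v j) = (1 / 2 : ℝ) * ∑ i, v i ^ 2 := by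
      rw [Finset.mul_sum]
      refine Finset.sum_congr rfl fun i _ => ?_
      rw [Finset.sum_eq_single i (fun j _ hji => by rw [if_neg (Ne.symm hji), zero_mul])
        (fun hi => absurd (Finset.mem_univ i) hi), if_pos rfl, sq]
    rw [h1]
    obtain ⟨i, hi⟩ : ∃ i, v i ≠ 0 := by
      by_contra h
      push Not at h
      exact hv (funext h)
    have h2 : 0 < ∑ i, v i ^ 2 := by
      refine lt_of_lt_of_le (by positivity : (0 : ℝ) < v i ^ 2) ?_
      exact Finset.single_le_sum (fun j _ => sq_nonneg (v j)) (Finset.mem_univ i)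
    positivity
  have hc : ContDiffOn ℝ ∞ (fun x : ZM => luscherPotential x - E) univ :=
    (hV.sub contDiff_const).contDiffOn
  have hG : ContDiffOn ℝ ∞ (fun _ : ZM => (0 : ℝ)) univ := contDiffOn_const
  have hwΩ : LocallyIntegrableOn w univ volume := hw.locallyIntegrableOn univ
  have hweak' : ∀ φ : ZM → ℝ, ContDiff ℝ ∞ φ → HasCompactSupport φ → tsupport φ ⊆ univ →
      ∫ x, w x * ((∑ i, ∑ j, fderiv ℝ (fun y => (if i = j then (1 / 2 : ℝ) else 0) *
          fderiv ℝ φ y ((EuclideanSpace.basisFun (Fin 3 × Fin 3) ℝ).toBasis i)) x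
            ((EuclideanSpace.basisFun (Fin 3 × Fin 3) ℝ).toBasis j)) -
        (luscherPotential x - E) * φ x) = ∫ x, (0 : ℝ) * φ x := by
    intro φ hφ hφs _
    have hφ2 : ContDiff ℝ 2 φ := contDiff_infty.1 hφ 2
    have hφt : IsTestFn φ := ⟨hφ2, hφs⟩
    simp only [basisFun_toBasis_apply, zero_mul, integral_zero]
    have hpt : ∀ x, w x * ((∑ i : Fin 3 × Fin 3, ∑ j : Fin 3 × Fin 3,
        fderiv ℝ (fun y => (if i = j then (1 / 2 : ℝ) else 0) * fderiv ℝ φ y (unitDir i)) x (unitDir j)) -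
          (luscherPotential x - E) * φ x) = E * (w x * φ x) - w x * hApply φ x := by
      intro x
      rw [sum_fderiv_half_delta_eq_half_laplacian hφ2 x, hApply_def]
      ring
    simp_rw [hpt]
    have I1 : Integrable (fun x => w x * hApply φ x) :=
      integrable_mul_of_locallyIntegrable hw (continuous_hApply hφ2) (hasCompactSupport_hApply hφt)
    have I2 : Integrable (fun x => w x * φ x) :=
      integrable_mul_of_locallyIntegrable hw hφ.continuous hφs
    rw [integral_sub (I2.const_mul E) I1, integral_const_mul, hweak φ hφ hφs, sub_self]
  obtain ⟨U, hUo, hx₀U, -, w', hw', hae⟩ :=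
    exists_contDiffOn_ae_eq_of_divForm_weak volume (EuclideanSpace.basisFun (Fin 3 × Fin 3) ℝ).toBasis
      Folland1995_cor634_holds isOpen_univ ha hpos hc hG hwΩ hweak' (mem_univ x₀)
  exact ⟨U, hUo, hx₀U, w', hw', hae⟩

/-- ★ **Weak eigenfunctions are smooth classical eigenfunctions.**  If `w ∈ L¹_loc(ℝ⁹)` satisfies
`∫ w (−½Δφ + Vφ) = E ∫ w φ` for all `φ ∈ C_c^∞(ℝ⁹)`, then there is `w̃ ∈ C^∞(ℝ⁹)` with `w = w̃` a.e. and
`−½Δw̃(x) + V(x)w̃(x) = E w̃(x)` for every `x`.  (Interior regularity of Folland Cor. (6.34) near each point, the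
gluing lemma `exists_contDiff_ae_eq_of_locally`, Green's second identity and the fundamental lemma of the
calculus of variations.) [cite: Folland2020, Cor. (6.34)] -/
theorem exists_contDiff_classical_of_weak (hw : LocallyIntegrable w volume)
    (hweak : ∀ φ : ZM → ℝ, ContDiff ℝ ∞ φ → HasCompactSupport φ →
      ∫ x, w x * hApply φ x = E * ∫ x, w x * φ x) :
    ∃ w' : ZM → ℝ, ContDiff ℝ ∞ w' ∧ w =ᵐ[volume] w' ∧ ∀ x, hApply w' x = E * w' x := by
  -- the global smooth representative
  obtain ⟨w', hw', hae⟩ := exists_contDiff_ae_eq_of_locally (μ := volume) (n := ∞)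
    (exists_local_contDiffOn_rep_of_weak hw hweak)
  refine ⟨w', hw', hae, ?_⟩
  have hw'2 : ContDiff ℝ 2 w' := contDiff_infty.1 hw' 2
  have hw'c : Continuous w' := hw'.continuous
  -- the distributional equation for `w'`, derivatives moved onto `w'`
  have hzero : ∀ φ : ZM → ℝ, ContDiff ℝ ∞ φ → HasCompactSupport φ →
      ∫ x, φ x • (hApply w' x - E * w' x) = 0 := by
    intro φ hφ hφs
    have hφ2 : ContDiff ℝ 2 φ := contDiff_infty.1 hφ 2
    have hφt : IsTestFn φ := ⟨hφ2, hφs⟩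
    have h1 : ∫ x, w' x * hApply φ x = ∫ x, w x * hApply φ x :=
      integral_congr_ae (by filter_upwards [hae] with x hx; rw [hx])
    have h2 : ∫ x, w' x * φ x = ∫ x, w x * φ x :=
      integral_congr_ae (by filter_upwards [hae] with x hx; rw [hx])
    have h3 : ∫ x, hApply w' x * φ x = E * ∫ x, w' x * φ x := by
      rw [integral_hApply_mul_eq_integral_mul_hApply hw'2 hφt, h1, hweak φ hφ hφs, h2]
    have I1 : Integrable (fun x => hApply w' x * φ x) :=
      ((continuous_hApply hw'2).mul hφ.continuous).integrable_of_hasCompactSupport hφs.mul_left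
    have I2 : Integrable (fun x => w' x * φ x) :=
      (hw'c.mul hφ.continuous).integrable_of_hasCompactSupport hφs.mul_left
    have h4 : (fun x => φ x • (hApply w' x - E * w' x)) =
        fun x => hApply w' x * φ x - E * (w' x * φ x) := by
      funext x; simp only [smul_eq_mul]; ring
    rw [h4, integral_sub I1 (I2.const_mul E), integral_const_mul, h3, sub_self]
  have hcont : Continuous fun x => hApply w' x - E * w' x :=
    (continuous_hApply hw'2).sub (continuous_const.mul hw'c)
  have hae0 : ∀ᵐ x ∂volume, hApply w' x - E * w' x = 0 :=
    ae_eq_zero_of_integral_contDiff_smul_eq_zero (hcont.locallyIntegrable (μ := volume)) hzero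
  have heq : (fun x => hApply w' x - E * w' x) = fun _ => (0 : ℝ) :=
    (Continuous.ae_eq_iff_eq volume hcont continuous_const).1 hae0
  intro x
  have h5 : hApply w' x - E * w' x = 0 := congr_fun heq x
  linarith

/-- The smooth representative is a `C^n` function for every `n : ℕ∞` (the format of the named fact AL1,
`LuscherHamiltonianEigenfunctions`). [cite: GilbargTrudinger2001, Cor. 8.11] -/
theorem exists_smooth_classical_of_weak (hw : LocallyIntegrable w volume)
    (hweak : ∀ φ : ZM → ℝ, ContDiff ℝ ∞ φ → HasCompactSupport φ →
      ∫ x, w x * hApply φ x = E * ∫ x, w x * φ x) :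
    ∃ w' : ZM → ℝ, (∀ n : ℕ∞, ContDiff ℝ n w') ∧ w =ᵐ[volume] w' ∧ ∀ x, hApply w' x = E * w' x := by
  obtain ⟨w', hw', hae, hcl⟩ := exists_contDiff_classical_of_weak hw hweak
  exact ⟨w', fun n => hw'.of_le (WithTop.coe_le_coe.2 le_top), hae, hcl⟩

/-- `L²` functions on `ℝ⁹` are locally integrable (the form in which the weak eigenfunctions of
`exists_core_form_eigenseq` arrive). [cite: LiebLoss2001, Thm. 11.7] -/
theorem locallyIntegrable_of_memLp_two (hw : MemLp w 2 volume) : LocallyIntegrable w volume :=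
  hw.locallyIntegrable (by norm_num)

end Regularity

end Literature.Analysis.OperatorTheory.YMMatrixModel

end
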